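import Literature.Topology.Euclidean.BrouwerNormedSpace
import HarnessLib

/-!
# Zeros of small continuous perturbations of an invertible linear map (the finite-dimensional
# "degree argument" of gluing constructions, via Brouwer)

Topic `Literature/Topology/Euclidean` (namespace `Literature.Topology.Euclidean.Brouwer`).
Everything in this file is PROVED; there are no definitions and no named facts.

In gluing constructions for the Einstein constraint equations the obstruction space (cokernel of
the linearised constraint map) is finite-dimensional and is absorbed by finitely many parameters of
a model family; the last step is always the same piece of finite-dimensional topology: a map of the
form `𝓘(p) = L p + e + Q(p)` on a small ball, with `L` an invertible linear map, `‖e‖ ≤ C₁ ε` and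
`‖Q(p)‖ ≤ C₂ ε²` for `‖p‖ ≤ C₀ ε`, has a zero in that ball once `ε` is small — proved in print by a
degree (homotopy-invariance) argument: Li–Mei, *A construction of collapsing spacetimes in vacuum*,
arXiv:2005.01249, proof of Prop. 4.1, p. 25 (`𝓘(m, a⃗) = (8π(m − m₀), −8π m₀ a⃗) + (ε₀, ε⃗) + O(ε²)`,
"we then use a degree argument similar to [L-Y] … `𝓘(m, a⃗)` has a zero in `B_{C₀ε}`"), after
Li–Yu, Ann. of Math. 181 (2015), §7; likewise Corvino 2000, §4 and Corvino–Schoen 2006, §5 (centre of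
mass and angular momentum). Here the zero is produced by **Brouwer's fixed point theorem**
(`Literature.Topology.Euclidean.Brouwer.exists_fixedPoint_closedBall_of_finiteDimensional`, proved
in the tree) applied to `p ↦ −L⁻¹(e + Q(p))`, which is a genuinely shorter road to the same
conclusion than the degree computation (no mapping degree is available in Mathlib):

* `exists_zero_linear_add_of_mapsTo` — if `p ↦ −L⁻¹(e + Q p)` maps a closed ball into itself and
  `Q` is continuous there, then `L p + e + Q p = 0` for some `p` in the ball;
* `exists_zero_linear_add_of_norm_le` — **the quantitative form used in gluing**: `‖e‖ ≤ C₁ε`,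
  `‖Q p‖ ≤ C₂ε²` on `closedBall 0 (C₀ε)`, `‖L⁻¹‖ (C₁ + C₂ε) ≤ C₀` ⟹ a zero with `‖p‖ ≤ C₀ε`;
* `exists_zero_linear_add_of_small` — the "for `ε` sufficiently small" phrasing: given `L`, `C₁`,
  `C₂ ≥ 0` there are `C₀` and `ε₁ > 0` (explicit: `C₀ = 2‖L⁻¹‖C₁ + 1`, `ε₁ = 1/(2‖L⁻¹‖C₂ + 1)`)
  such that for every `0 ≤ ε ≤ ε₁` every such `𝓘` has a zero in `closedBall 0 (C₀ε)`.

## References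

* J. Li, H. Mei, Comm. Math. Phys. 378 (2020), arXiv:2005.01249, proof of Prop. 4.1, p. 25
  (key `LiMei2020`).
* T. Tao, *Hilbert's Fifth Problem and Related Topics* (2014), Thm. 6.2.1 (Brouwer) (key `Tao2014`).
* J. Corvino, Comm. Math. Phys. 214 (2000), §4 (key `Corvino2000`).
-/

noncomputable section

open Metric Set Filter Topology

namespace Literature.Topology.Euclidean.Brouwer

variable {F : Type*} [NormedAddCommGroup F] [NormedSpace ℝ F] [FiniteDimensional ℝ F]

/-- **Zeros of `L + e + Q` from Brouwer.** Let `L : F ≃L[ℝ] F` be an invertible continuous linear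
map of a finite-dimensional real normed space, `e ∈ F`, and `Q : F → F` continuous on the closed
ball `closedBall c R` (`0 ≤ R`). If `p ↦ −L⁻¹(e + Q p)` maps `closedBall c R` into itself, then
`L p + e + Q p = 0` for some `p ∈ closedBall c R`: a fixed point `p = −L⁻¹(e + Q p)`
(`exists_fixedPoint_closedBall_of_finiteDimensional`) is such a zero. This replaces the degree
argument of Li–Mei arXiv:2005.01249, p. 25. [cite: Tao2014, Thm. 6.2.1] -/
theorem exists_zero_linear_add_of_mapsTo (L : F ≃L[ℝ] F) {e c : F} {R : ℝ} (hR : 0 ≤ R)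
    {Q : F → F} (hQ : ContinuousOn Q (closedBall c R))
    (hmaps : ∀ p ∈ closedBall c R, -(L.symm (e + Q p)) ∈ closedBall c R) :
    ∃ p ∈ closedBall c R, L p + e + Q p = 0 := by
  set T : F → F := fun p ↦ -(L.symm (e + Q p)) with hT
  have hTc : ContinuousOn T (closedBall c R) :=
    (L.symm.continuous.comp_continuousOn (continuousOn_const.add hQ)).neg
  obtain ⟨p, hp, hfix⟩ := exists_fixedPoint_closedBall_of_finiteDimensional hR hTc hmaps
  refine ⟨p, hp, ?_⟩
  have h : L p = -(e + Q p) := by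
    conv_lhs => rw [← hfix]
    rw [hT]
    simp only [map_neg, ContinuousLinearEquiv.apply_symm_apply]
  rw [h]
  abel

/-- **The quantitative form** (Li–Mei arXiv:2005.01249, p. 25, with Brouwer in place of the degree
argument): let `L : F ≃L[ℝ] F`, `0 ≤ ε`, `0 ≤ C₀`, `‖e‖ ≤ C₁ ε`, `Q` continuous on
`closedBall 0 (C₀ ε)` with `‖Q p‖ ≤ C₂ ε²` there, and `‖L⁻¹‖ (C₁ + C₂ ε) ≤ C₀`. Then
`L p + e + Q p = 0` for some `p` with `‖p‖ ≤ C₀ ε`. (`‖−L⁻¹(e + Q p)‖ ≤ ‖L⁻¹‖ (C₁ε + C₂ε²) ≤ C₀ε`,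
so `exists_zero_linear_add_of_mapsTo` applies.) [cite: LiMei2020, proof of Prop. 4.1, p. 25] -/
theorem exists_zero_linear_add_of_norm_le (L : F ≃L[ℝ] F) {ε C₀ C₁ C₂ : ℝ} (hε : 0 ≤ ε)
    (hC₀ : 0 ≤ C₀) (hC : ‖(L.symm : F →L[ℝ] F)‖ * (C₁ + C₂ * ε) ≤ C₀) {e : F}
    (he : ‖e‖ ≤ C₁ * ε) {Q : F → F} (hQc : ContinuousOn Q (closedBall (0 : F) (C₀ * ε)))
    (hQ : ∀ p ∈ closedBall (0 : F) (C₀ * ε), ‖Q p‖ ≤ C₂ * ε ^ 2) :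
    ∃ p ∈ closedBall (0 : F) (C₀ * ε), L p + e + Q p = 0 := by
  refine exists_zero_linear_add_of_mapsTo L (mul_nonneg hC₀ hε) hQc fun p hp ↦ ?_
  rw [mem_closedBall_zero_iff, norm_neg]
  have h1 : ‖L.symm (e + Q p)‖ ≤ ‖(L.symm : F →L[ℝ] F)‖ * (‖e‖ + ‖Q p‖) :=
    ((L.symm : F →L[ℝ] F).le_opNorm _).trans
      (mul_le_mul_of_nonneg_left (norm_add_le _ _) (norm_nonneg _))
  have h2 : ‖e‖ + ‖Q p‖ ≤ (C₁ + C₂ * ε) * ε := by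
    have := hQ p hp
    nlinarith
  calc ‖L.symm (e + Q p)‖ ≤ ‖(L.symm : F →L[ℝ] F)‖ * (‖e‖ + ‖Q p‖) := h1
    _ ≤ ‖(L.symm : F →L[ℝ] F)‖ * ((C₁ + C₂ * ε) * ε) :=
        mul_le_mul_of_nonneg_left h2 (norm_nonneg _)
    _ = ‖(L.symm : F →L[ℝ] F)‖ * (C₁ + C₂ * ε) * ε := by ring
    _ ≤ C₀ * ε := mul_le_mul_of_nonneg_right hC hε

/-- **"If `ε` is sufficiently small, `𝓘` has a zero in `B_{C₀ε}`"** (Li–Mei arXiv:2005.01249,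
p. 25): for an invertible `L` and constants `C₁, C₂ ≥ 0` there are `C₀ ≥ 0` and `ε₁ > 0` —
explicitly `C₀ = 2‖L⁻¹‖C₁ + 1`, `ε₁ = (2‖L⁻¹‖C₂ + 1)⁻¹` — such that for every `0 ≤ ε ≤ ε₁`, every
`e` with `‖e‖ ≤ C₁ε` and every `Q` continuous on `closedBall 0 (C₀ε)` with `‖Q p‖ ≤ C₂ε²` there,
the map `p ↦ L p + e + Q p` has a zero `p` with `‖p‖ ≤ C₀ε`. [cite: LiMei2020, proof of Prop. 4.1, p. 25] -/
theorem exists_zero_linear_add_of_small (L : F ≃L[ℝ] F) {C₁ C₂ : ℝ} (hC₁ : 0 ≤ C₁) (hC₂ : 0 ≤ C₂) :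
    ∃ C₀ ε₁ : ℝ, 0 ≤ C₀ ∧ 0 < ε₁ ∧ ∀ ε : ℝ, 0 ≤ ε → ε ≤ ε₁ →
      ∀ (e : F), ‖e‖ ≤ C₁ * ε → ∀ (Q : F → F), ContinuousOn Q (closedBall (0 : F) (C₀ * ε)) →
        (∀ p ∈ closedBall (0 : F) (C₀ * ε), ‖Q p‖ ≤ C₂ * ε ^ 2) →
          ∃ p ∈ closedBall (0 : F) (C₀ * ε), L p + e + Q p = 0 := by
  set N : ℝ := ‖(L.symm : F →L[ℝ] F)‖ with hN
  have hN0 : 0 ≤ N := norm_nonneg _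
  refine ⟨2 * N * C₁ + 1, (2 * N * C₂ + 1)⁻¹, by positivity, by positivity,
    fun ε hε hε₁ e he Q hQc hQ ↦ ?_⟩
  refine exists_zero_linear_add_of_norm_le L hε (by positivity) ?_ he hQc hQ
  -- `N (C₁ + C₂ ε) ≤ 2 N C₁ + 1`: `N C₂ ε ≤ N C₂ / (2 N C₂ + 1) ≤ 1/2`
  have h1 : N * C₂ * ε ≤ 2⁻¹ := by
    have hden : 0 < 2 * N * C₂ + 1 := by positivity
    have h : N * C₂ * ε ≤ N * C₂ * (2 * N * C₂ + 1)⁻¹ :=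
      mul_le_mul_of_nonneg_left hε₁ (by positivity)
    refine h.trans ?_
    rw [← div_eq_mul_inv, div_le_iff₀ hden]
    nlinarith
  nlinarith

end Literature.Topology.Euclidean.Brouwer

end
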